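import Mathlib
import HarnessLib
import Summits.HubbardSuperconductivity.HubbardSuperconductivity.Theorems.KLProgrammeKLRegimeCountertermJacksonSelfMap

/-!
# Route `KLProgramme` — child Counterterm of crux K3: THE SELF-MAP OF FRAMEOK'S TUBE UNDER AN ABSTRACT OFF-SLOT BUDGET
# (`frameOK_jackson_of_slotBudget`; seat hubbard-kl-k3c3-p2, technique «fixed point on FrameOK's tube (contraction in the frame norm)»)

Consumer census of (E3a-MS) (HOME/hubbard-kl-k3c3-p2/MS-CONSUMER.md §1, evidence #21 on stmt-HubbardSuperconductivity-19918).  The landed self-map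
`frameOK_jackson_of_multiSlotFn'` (`…CountertermJacksonSelfMap`) reads from the multi-slot clause `TwoLegSizesMST … K.eval i` exactly ONE inequality per
slot `m` and order `j ≤ 4`: own part + the fine parts of the coarser pieces `≤ R.Gfr j·uPow j U·4^{(j−2)m}`.  The U-power of the typed off-slot factor
`msBar i`, its proportionality to `R.Gfr j` and its `m`-profile are not read.  This file records that fact as a theorem: the same self-map with the
off-slot bound an ARBITRARY function `B i m j` of (coarse piece, slot, order), under the one «room» hypothesis the proof uses,

* §1 `norm_iteratedFDeriv_msPieceFn_le_of_budget` — slot-`m` bound of the aggregated slot function `msPieceFn lp n N m` from own part `≤ twoLegBar j m`,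
  fine parts `≤ B i m j` and the room `twoLegBar j m + Σ_{i ≤ n, i < m} B i m j ≤ Gfr j·uPow j U·4^{(j−2)m}`;
* §2 **`frameOK_jackson_of_slotBudget`** — for EVERY degree `d`, `FrameOK R U (nScales β) μ (jacksonFrame d (−Σ_{i≤n} ℓ_i^{Fn}(K)))` from: multi-slot
  decompositions of the pieces `i ≤ n` with symmetric `C⁴` slot functions, own-slot sizes `twoLegBar`, fine sizes `B`, the room at every slot `m ≤ nScales β`,
  and the three allowance sums of orders `≤ 2` on the window ((J1)/(J2) + `frameOK_of_pieces`, as in the landed proof);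
* §3 instances: today's shape `B i m j = msBar i·(Gfr j·uPow j·4^{(j−2)m})` under today's sharp room IS the landed
  `frameOK_jackson_of_multiSlotFn'` (not restated); `frameOK_jackson_of_geomBudget` — the shape `(msBar i + κ·(1/2)^{m−i})·((Gfr j + S j + 1)·uPow j·4^{(j−2)m})`
  (slope part + U-free geometric part, floor `Gfr j + S j + 1`) under the closed-form room `Gfr j = 2(S j + 1)`, `S′ j·|U| ≤ 1/2`,
  `Σ_{i≤n} msBar i + κ ≤ 1/3` — the consumer side of the budget shapes MS-CONSUMER §1 (C2) lists as free for child 2.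

Proofs only (no definitions); nothing is asserted about the Hubbard model; no slot text is proposed here.
-/

noncomputable section

namespace Summit.HubbardSuperconductivity.HubbardSuperconductivity.Theorems.KLRegimeSplit

set_option linter.dupNamespace false -- summit = problem name (single-conjunct summit), D-0017

open Real Finset
open Literature.MathematicalPhysics.QuantumLattice Literature.Probability.LatticeModels
open Summit.HubbardSuperconductivity.HubbardSuperconductivity.Theorems.KLProgrammeLegKernels

/-! ## §1 The aggregated slot function under an abstract off-slot budget -/

/-- **Slot-`m` bound of the aggregated slot function, ABSTRACT off-slot budget.**  If the own part obeys `‖Dʲ lp m m‖ ≤ twoLegBar j m` (when `m ≤ n`),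
the fine parts obey `‖Dʲ lp i m‖ ≤ B i m j` (`i ≤ n`, `m ∈ Ioc i N`), and the room `twoLegBar j m + Σ_{i ≤ n, i < m} B i m j ≤ Gfr j·uPow j U·4^{(j−2)m}`
holds, then `‖Dʲ (msPieceFn lp n N m)‖ ≤ Gfr j·uPow j U·4^{(j−2)m}`. -/
theorem norm_iteratedFDeriv_msPieceFn_le_of_budget {G : GeoConsts} {Q : EngConsts} {R : RenConsts} (hG : G.WF) (hQ : Q.WF) {U : ℝ}
    {lp : ℕ → ℕ → FrameFn} (hlps : ∀ i m, ContDiff ℝ 4 (onM (lp i m))) {B : ℕ → ℕ → ℕ → ℝ} (hB : ∀ i m j, 0 ≤ B i m j) {n N m j : ℕ}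
    (hj : j ≤ 4) (hdiag : m ≤ n → ∀ q : Momentum, ‖iteratedFDeriv ℝ j (onM (lp m m)) q‖ ≤ twoLegBar G Q U j m)
    (hfine : ∀ i ≤ n, m ∈ Ioc i N → ∀ q : Momentum, ‖iteratedFDeriv ℝ j (onM (lp i m)) q‖ ≤ B i m j)
    (hroom : twoLegBar G Q U j m + ∑ i ∈ (range (n + 1)).filter (· < m), B i m j ≤ R.Gfr j * uPow j U * (4 : ℝ) ^ (((j : ℤ) - 2) * m))
    (q : Momentum) :
    ‖iteratedFDeriv ℝ j (onM (msPieceFn lp n N m)) q‖ ≤ R.Gfr j * uPow j U * (4 : ℝ) ^ (((j : ℤ) - 2) * m) := by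
  classical
  have hfun : onM (msPieceFn lp n N m) =
      fun x => ∑ i ∈ range (n + 1), onM (if m ∈ insert i (Ioc i N) then lp i m else fun _ => 0) x := by
    funext x; simp [onM, msPieceFn]
  have hterm_smooth : ∀ i, ContDiff ℝ 4 (onM (if m ∈ insert i (Ioc i N) then lp i m else fun _ => 0)) := by
    intro i; split_ifs
    · exact hlps i m
    · exact contDiff_const
  rw [hfun, iteratedFDeriv_fun_sum_apply fun i _ =>
    ((hterm_smooth i).of_le (by exact_mod_cast hj)).contDiffAt]
  refine (norm_sum_le _ _).trans ?_
  -- termwise: the own part at `i = m`, the fine parts at `i < m`, zero otherwise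
  have hterm : ∀ i ∈ range (n + 1),
      ‖iteratedFDeriv ℝ j (onM (if m ∈ insert i (Ioc i N) then lp i m else fun _ => 0)) q‖ ≤
        (if i = m then twoLegBar G Q U j m else 0) + (if i < m then B i m j else 0) := by
    intro i hi
    have hin : i ≤ n := Nat.lt_succ_iff.mp (mem_range.mp hi)
    have h1 : 0 ≤ (if i = m then twoLegBar G Q U j m else 0) := by
      split_ifs
      · exact twoLegBar_nonneg' hG hQ U j m
      · exact le_rfl
    have h2 : 0 ≤ (if i < m then B i m j else 0) := by
      split_ifs
      · exact hB i m j
      · exact le_rfl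
    by_cases hc : m ∈ insert i (Ioc i N)
    · rw [if_pos hc]
      rcases mem_insert.mp hc with hmi | hIoc
      · subst hmi
        rw [if_pos rfl]
        have := hdiag hin q
        linarith
      · have hlt : i < m := (mem_Ioc.mp hIoc).1
        have hne : i ≠ m := hlt.ne
        rw [if_neg hne, zero_add, if_pos hlt]
        exact hfine i hin hIoc q
    · rw [if_neg hc]
      have hz : onM (fun _ : Fin 2 → ℝ => (0 : ℝ)) = fun _ => 0 := by funext x; simp [onM]
      rw [hz, iteratedFDeriv_fun_zero]
      simp only [Pi.zero_apply, norm_zero]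
      linarith
  refine (sum_le_sum hterm).trans ?_
  rw [sum_add_distrib, sum_ite_eq' (range (n + 1)) m, ← sum_filter]
  have hdiagsum : (if m ∈ range (n + 1) then twoLegBar G Q U j m else 0) ≤ twoLegBar G Q U j m := by
    split_ifs
    · exact le_rfl
    · exact twoLegBar_nonneg' hG hQ U j m
  linarith

/-! ## §2 The self-map under an abstract off-slot budget -/

section Model

variable {L M : ℕ} [NeZero L] [NeZero M]

/-- **SELF-MAP OF FRAMEOK'S TUBE UNDER THE SMOOTHED PICARD STEP, ABSTRACT OFF-SLOT BUDGET.**  Suppose every function piece `ℓ_i^{Fn}(K)`,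
`i ≤ n ≤ nScales β`, splits over the slots `m ≥ i` as `ℓ_i = lp i + Σ_{m ∈ Ioc i N} lp m` with symmetric `C⁴` slot functions, the own part within
the scale-`i` majorants `twoLegBar j i` (`j ≤ 4`) and the fine parts within an ARBITRARY budget `B i m j ≥ 0`; suppose the room
`twoLegBar j m + Σ_{i ≤ n, i < m} B i m j ≤ Gfr j·uPow j U·4^{(j−2)m}` at every slot `m ≤ N` and order `j ≤ 4`, and the three allowance sums of orders
`≤ 2` small on the window.  Then for EVERY degree `d` the smoothed wholesale iterate `jacksonFrame d (−Σ_{i≤n} ℓ_i^{Fn}(K))` is an ADMISSIBLE frame.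
(The landed `frameOK_jackson_of_multiSlotFn'` is the instance `B i m j = msBar i·(Gfr j·uPow j U·4^{(j−2)m})`, §3.) -/
theorem frameOK_jackson_of_slotBudget {G : GeoConsts} {Q : EngConsts} {R : RenConsts} (hG : G.WF) (hQ : Q.WF)
    (hR : ∀ j, 0 ≤ R.Gfr j) {β U μ : ℝ} {K : TrigPolyC4v} {n : ℕ} (hn : n ≤ nScales β) (hμ : μ ∈ Set.Icc (-1.05 : ℝ) (-0.15))
    {B : ℕ → ℕ → ℕ → ℝ} (hB : ∀ i m j, 0 ≤ B i m j)
    (hMS : ∀ i ≤ n, ∃ lp : ℕ → FrameFn,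
      (∀ p : Fin 2 → ℝ, klTwoLegPieceFn L M β U μ K.eval i p = lp i p + ∑ m ∈ Ioc i (nScales β), lp m p) ∧
      (∀ m, IsSymmetricFrame (lp m) ∧ ContDiff ℝ 4 (onM (lp m))) ∧
      (∀ j ≤ 4, ∀ q : Momentum, ‖iteratedFDeriv ℝ j (onM (lp i)) q‖ ≤ twoLegBar G Q U j i) ∧
      (∀ m ∈ Ioc i (nScales β), ∀ j ≤ 4, ∀ q : Momentum, ‖iteratedFDeriv ℝ j (onM (lp m)) q‖ ≤ B i m j))
    (hroom : ∀ m ≤ nScales β, ∀ j ≤ 4,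
      twoLegBar G Q U j m + ∑ i ∈ (range (n + 1)).filter (· < m), B i m j ≤ R.Gfr j * uPow j U * (4 : ℝ) ^ (((j : ℤ) - 2) * m))
    (h0 : ∑ m ∈ range (nScales β + 1), R.Gfr 0 * uPow 0 U * (4 : ℝ) ^ (((0 : ℤ) - 2) * m) ≤ 3 / 80)
    (h1 : ∑ m ∈ range (nScales β + 1), R.Gfr 1 * uPow 1 U * (4 : ℝ) ^ (((1 : ℤ) - 2) * m) ≤ 1 / 2000)
    (h2 : ∑ m ∈ range (nScales β + 1), ∑ j ∈ range 3, R.Gfr j * uPow j U * (4 : ℝ) ^ (((j : ℤ) - 2) * m) ≤ 1 / 100) (d : ℕ) :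
    FrameOK R U (nScales β) μ
      (jacksonFrame d fun q => -∑ i ∈ range (n + 1), klTwoLegPieceFn L M β U μ K.eval i q) := by
  classical
  -- choose the multi-slot decompositions of the pieces `i ≤ n` (zero beyond `n`)
  have hch : ∀ i, ∃ lp : ℕ → FrameFn, (∀ m, IsSymmetricFrame (lp m) ∧ ContDiff ℝ 4 (onM (lp m))) ∧ (i ≤ n →
      (∀ p : Fin 2 → ℝ,
          klTwoLegPieceFn L M β U μ K.eval i p = lp i p + ∑ m ∈ Ioc i (nScales β), lp m p) ∧
      (∀ j ≤ 4, ∀ q : Momentum, ‖iteratedFDeriv ℝ j (onM (lp i)) q‖ ≤ twoLegBar G Q U j i) ∧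
      (∀ m ∈ Ioc i (nScales β), ∀ j ≤ 4, ∀ q : Momentum, ‖iteratedFDeriv ℝ j (onM (lp m)) q‖ ≤ B i m j)) := by
    intro i
    by_cases hi : i ≤ n
    · obtain ⟨lp, hdec, hsym, hd, hf⟩ := hMS i hi
      exact ⟨lp, hsym, fun _ => ⟨hdec, hd, hf⟩⟩
    · refine ⟨fun _ _ => 0, fun _ => ⟨isSymmetricFrame_zero, ?_⟩, fun h => absurd h hi⟩
      have hz : onM (fun _ : Fin 2 → ℝ => (0 : ℝ)) = fun _ => 0 := by funext x; simp [onM]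
      rw [hz]; exact contDiff_const
  choose lp hreg hlp using hch
  set N := nScales β with hN
  -- the symbol and its slot decomposition
  set Φ : FrameFn := fun q => -∑ i ∈ range (n + 1), klTwoLegPieceFn L M β U μ K.eval i q with hΦ
  have hΦeq : ∀ q, Φ q = -∑ m ∈ range (N + 1), msPieceFn lp n N m q := by
    intro q
    simp only [hΦ]
    rw [← sum_multiSlotFn_eq_sum_msPieceFn lp hn q]
    congr 1
    exact sum_congr rfl fun i hi => (hlp i (Nat.lt_succ_iff.mp (mem_range.mp hi))).1 q
  have hsymP : ∀ m, IsSymmetricFrame (msPieceFn lp n N m) := fun m =>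
    isSymmetricFrame_msPieceFn (fun i m => (hreg i m).1) n N m
  have hsmP : ∀ m, ContDiff ℝ 4 (onM (msPieceFn lp n N m)) := fun m =>
    contDiff_onM_msPieceFn (fun i m => (hreg i m).2) n N m
  have hcP : ∀ m, Continuous (msPieceFn lp n N m) := fun m => continuous_of_contDiff_onM (hsmP m)
  have hΦfun : Φ = fun q => -∑ m ∈ range (N + 1), msPieceFn lp n N m q := funext hΦeq
  have hsymΦ : IsSymmetricFrame Φ := by
    rw [hΦfun]; exact (isSymmetricFrame_finset_sum _ fun m _ => hsymP m).neg'
  have hcΦ : Continuous Φ := by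
    rw [hΦfun]; exact (continuous_finsetSum _ fun m _ => hcP m).neg
  -- the sum identity of FrameOK (ii): `E = −Σ_m 𝒥(msPieceFn m)`
  have hsumE : ∀ p : Fin 2 → ℝ, (jacksonFrame d Φ).eval p =
      ∑ m ∈ range (N + 1), (fsub 0 (jacksonFrame d (msPieceFn lp n N m))).eval p := by
    intro p
    rw [eval_jacksonFrame hcΦ hsymΦ.1 hsymΦ.2.1 hsymΦ.2.2, hΦfun, jsmooth_neg,
      jsmooth_finset_sum d _ _ (fun m _ => hcP m), ← sum_neg_distrib]
    refine sum_congr rfl fun m _ => ?_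
    rw [eval_fsub, TrigPolyC4v.eval_zero, zero_sub, eval_jacksonFrame (hcP m) (hsymP m).1 (hsymP m).2.1 (hsymP m).2.2]
  refine frameOK_of_pieces hR hμ (Kp := fun m => jacksonFrame d (msPieceFn lp n N m)) hsumE ?_ h0 h1 h2
  -- the slot bounds pass through the smoothing with constant one (J2)
  intro m hm j hj q
  have hBd : ∀ i ≤ 4, ∀ x : EuclideanSpace ℝ (Fin 2),
      ‖iteratedFDeriv ℝ i (fun x : EuclideanSpace ℝ (Fin 2) => msPieceFn lp n N m (WithLp.ofLp x)) x‖ ≤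
        R.Gfr i * uPow i U * (4 : ℝ) ^ (((i : ℤ) - 2) * m) := by
    intro i hi x
    exact norm_iteratedFDeriv_msPieceFn_le_of_budget hG hQ (fun i m => (hreg i m).2) hB hi
      (fun hmn q => (hlp m hmn).2.1 i hi q) (fun i' hi' hIoc q => (hlp i' hi').2.2 m hIoc i hi q) (hroom m hm i hi) x
  exact (norm_iteratedFDeriv_eval_jacksonFrame_le d (hcP m) (hsymP m).1 (hsymP m).2.1 (hsymP m).2.2 (m := 4)
    (hsmP m) hBd).2 j hj q

/-! ## §3 Instances: today's `msBar` shape (landed), and slope + U-free geometric part with the `Gfr j + S j + 1` floor -/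

/- Today's shape `B i m j = msBar i·(Gfr j·uPow j U·4^{(j−2)m})` with the sharp room `S_j + S′_j|U| + (Σ_{i≤n} msBar i)·Gfr_j ≤ Gfr_j` is the
LANDED `frameOK_jackson_of_multiSlotFn'` (…CountertermJacksonSelfMap, p485425) — an instance of §2 (the room rewrites as
`(S_j + S′_j|U|)·W + (Σ_{i ≤ n, i < m} msBar i)·Gfr_j·W ≤ ((S_j + S′_j|U|) + (Σ_{i≤n} msBar i)·Gfr_j)·W ≤ Gfr_j·W`); not restated here (dedup). -/

/-- The geometric coefficients sum to at most `κ`: `Σ_{i ≤ n, i < m} κ·(1/2)^{m−i} ≤ κ` (for `κ ≥ 0`). -/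
theorem sum_geomCoeff_le {κ : ℝ} (hκ : 0 ≤ κ) (n m : ℕ) :
    ∑ i ∈ (range (n + 1)).filter (· < m), κ * (1 / 2 : ℝ) ^ (m - i) ≤ κ := by
  classical
  have hgeom : ∀ m' : ℕ, ∑ k ∈ range m', (1 / 2 : ℝ) ^ (k + 1) = 1 - (1 / 2 : ℝ) ^ m' := by
    intro m'
    induction m' with
    | zero => simp
    | succ m' ih => rw [sum_range_succ, ih]; ring
  have hsub : (range (n + 1)).filter (· < m) ⊆ range m := by
    intro i hi
    exact mem_range.mpr (mem_filter.mp hi).2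
  have hnn : ∀ i ∈ range m, 0 ≤ κ * (1 / 2 : ℝ) ^ (m - i) := fun i _ => mul_nonneg hκ (pow_nonneg (by norm_num) _)
  refine (sum_le_sum_of_subset_of_nonneg hsub fun i hi _ => hnn i hi).trans ?_
  rw [← mul_sum]
  refine (mul_le_mul_of_nonneg_left ?_ hκ).trans (le_of_eq (mul_one κ))
  -- `Σ_{i < m} (1/2)^{m−i} = Σ_{k=1}^{m} (1/2)^k ≤ 1`
  have hreindex : ∑ i ∈ range m, (1 / 2 : ℝ) ^ (m - i) = ∑ k ∈ range m, (1 / 2 : ℝ) ^ (k + 1) := by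
    rw [← sum_range_reflect]
    refine sum_congr rfl fun k hk => ?_
    have hk' : k < m := mem_range.mp hk
    congr 1
    omega
  rw [hreindex, hgeom m]
  have : 0 ≤ (1 / 2 : ℝ) ^ m := pow_nonneg (by norm_num) _
  linarith

/-- **The slope + U-free geometric shape with the `Gfr j + S j + 1` floor, as an instance** (MS-CONSUMER §1 (C2)): fine parts
`≤ (msBar i + κ·(1/2)^{m−i})·((Gfr j + S j + 1)·uPow j U·4^{(j−2)m})`; closed-form room: `Gfr j = 2(S j + 1)` (child 2's package choice),
`S′ j·|U| ≤ 1/2` and `Σ_{i≤n} msBar i + κ ≤ 1/3` (`κ ≥ 0`; both are `U₀`-conditions of child 2). -/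
theorem frameOK_jackson_of_geomBudget {G : GeoConsts} {Q : EngConsts} {R : RenConsts} (hG : G.WF) (hQ : Q.WF)
    (hR : ∀ j, 0 ≤ R.Gfr j) {β U μ : ℝ} {K : TrigPolyC4v} {n : ℕ} (hn : n ≤ nScales β) (hμ : μ ∈ Set.Icc (-1.05 : ℝ) (-0.15))
    {κ : ℝ} (hκ : 0 ≤ κ)
    (hMS : ∀ i ≤ n, ∃ lp : ℕ → FrameFn,
      (∀ p : Fin 2 → ℝ, klTwoLegPieceFn L M β U μ K.eval i p = lp i p + ∑ m ∈ Ioc i (nScales β), lp m p) ∧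
      (∀ m, IsSymmetricFrame (lp m) ∧ ContDiff ℝ 4 (onM (lp m))) ∧
      (∀ j ≤ 4, ∀ q : Momentum, ‖iteratedFDeriv ℝ j (onM (lp i)) q‖ ≤ twoLegBar G Q U j i) ∧
      (∀ m ∈ Ioc i (nScales β), ∀ j ≤ 4, ∀ q : Momentum, ‖iteratedFDeriv ℝ j (onM (lp m)) q‖ ≤
        (msBar G Q U i + κ * (1 / 2 : ℝ) ^ (m - i)) * ((R.Gfr j + G.S j + 1) * uPow j U * (4 : ℝ) ^ (((j : ℤ) - 2) * m))))
    (hGfr : ∀ j ≤ 4, R.Gfr j = 2 * (G.S j + 1)) (hS' : ∀ j ≤ 4, Q.S' j * |U| ≤ 1 / 2)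
    (hsmall : (∑ i ∈ range (n + 1), msBar G Q U i) + κ ≤ 1 / 3)
    (h0 : ∑ m ∈ range (nScales β + 1), R.Gfr 0 * uPow 0 U * (4 : ℝ) ^ (((0 : ℤ) - 2) * m) ≤ 3 / 80)
    (h1 : ∑ m ∈ range (nScales β + 1), R.Gfr 1 * uPow 1 U * (4 : ℝ) ^ (((1 : ℤ) - 2) * m) ≤ 1 / 2000)
    (h2 : ∑ m ∈ range (nScales β + 1), ∑ j ∈ range 3, R.Gfr j * uPow j U * (4 : ℝ) ^ (((j : ℤ) - 2) * m) ≤ 1 / 100) (d : ℕ) :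
    FrameOK R U (nScales β) μ
      (jacksonFrame d fun q => -∑ i ∈ range (n + 1), klTwoLegPieceFn L M β U μ K.eval i q) := by
  classical
  set B : ℕ → ℕ → ℕ → ℝ := fun i m j =>
    (msBar G Q U i + κ * (1 / 2 : ℝ) ^ (m - i)) * ((R.Gfr j + G.S j + 1) * uPow j U * (4 : ℝ) ^ (((j : ℤ) - 2) * m)) with hB_def
  have hS : ∀ j, 0 ≤ G.S j := fun j => hG.2.2.2.2.2.2.2.2.2.2.2.2.2.2.2.2.2.1 j
  have hS'0 : ∀ j, 0 ≤ Q.S' j := fun j => hQ.2.2.2.2.1 j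
  have hW : ∀ j m, 0 ≤ uPow j U * (4 : ℝ) ^ (((j : ℤ) - 2) * (m : ℕ)) := fun j m =>
    mul_nonneg (uPow_nonneg j U) (zpow_nonneg (by norm_num) _)
  have hms : ∀ i, 0 ≤ msBar G Q U i := fun i => msBar_nonneg hG hQ U i
  have hcoef : ∀ i m, 0 ≤ msBar G Q U i + κ * (1 / 2 : ℝ) ^ (m - i) := fun i m =>
    add_nonneg (hms i) (mul_nonneg hκ (pow_nonneg (by norm_num) _))
  have hfloor : ∀ j, 0 ≤ R.Gfr j + G.S j + 1 := fun j => by have := hR j; have := hS j; positivity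
  have hB : ∀ i m j, 0 ≤ B i m j := fun i m j =>
    mul_nonneg (hcoef i m) (mul_nonneg (mul_nonneg (hfloor j) (uPow_nonneg j U)) (zpow_nonneg (by norm_num) _))
  refine frameOK_jackson_of_slotBudget hG hQ hR hn hμ hB (fun i hi => ?_) (fun m _ j hj => ?_) h0 h1 h2 d
  · obtain ⟨lp, hdec, hsym, hd, hf⟩ := hMS i hi
    exact ⟨lp, hdec, hsym, hd, fun m hm j hj q => by simpa only [hB_def] using hf m hm j hj q⟩
  · -- room: `(S_j + S′_j|U|)·W + (Σ msBar + κ)·(Gfr_j + S_j + 1)·W ≤ Gfr_j·W` with `Gfr_j = 2(S_j+1)`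
    set W : ℝ := uPow j U * (4 : ℝ) ^ (((j : ℤ) - 2) * m) with hW_def
    have hWm : 0 ≤ W := hW j m
    set F : ℝ := R.Gfr j + G.S j + 1 with hF_def
    have hF : 0 ≤ F := hfloor j
    -- the fine sum: split the coefficient, bound each part
    have hsum_ms : ∑ i ∈ (range (n + 1)).filter (· < m), msBar G Q U i ≤ ∑ i ∈ range (n + 1), msBar G Q U i :=
      sum_le_sum_of_subset_of_nonneg (filter_subset _ _) fun i _ _ => hms i
    have hsum_geo : ∑ i ∈ (range (n + 1)).filter (· < m), κ * (1 / 2 : ℝ) ^ (m - i) ≤ κ := sum_geomCoeff_le hκ n m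
    have hsub : ∑ i ∈ (range (n + 1)).filter (· < m), B i m j ≤
        ((∑ i ∈ range (n + 1), msBar G Q U i) + κ) * (F * W) := by
      have heq : ∑ i ∈ (range (n + 1)).filter (· < m), B i m j =
          (∑ i ∈ (range (n + 1)).filter (· < m), (msBar G Q U i + κ * (1 / 2 : ℝ) ^ (m - i))) * (F * W) := by
        rw [sum_mul]
        refine sum_congr rfl fun i _ => ?_
        rw [hB_def, hF_def, hW_def]; ring
      rw [heq, sum_add_distrib]
      exact mul_le_mul_of_nonneg_right (add_le_add hsum_ms hsum_geo) (mul_nonneg hF hWm)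
    have htlb : twoLegBar G Q U j m = (G.S j + Q.S' j * |U|) * W := by rw [hW_def]; unfold twoLegBar; ring
    have hGj := hGfr j hj
    have hS'j := hS' j hj
    have hSj := hS j
    have hfin : R.Gfr j * W = R.Gfr j * uPow j U * (4 : ℝ) ^ (((j : ℤ) - 2) * m) := by rw [hW_def]; ring
    -- arithmetic: `(S + 1/2) + (1/3)·(3S + 3) ≤ 2(S + 1)`
    have hFe : F = 3 * (G.S j + 1) := by rw [hF_def, hGj]; ring
    have hkey : (G.S j + Q.S' j * |U|) + ((∑ i ∈ range (n + 1), msBar G Q U i) + κ) * F ≤ R.Gfr j := by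
      rw [hFe, hGj]
      have h13 : ((∑ i ∈ range (n + 1), msBar G Q U i) + κ) * (3 * (G.S j + 1)) ≤ (1 / 3) * (3 * (G.S j + 1)) :=
        mul_le_mul_of_nonneg_right hsmall (by positivity)
      linarith
    have hkeyW : ((G.S j + Q.S' j * |U|) + ((∑ i ∈ range (n + 1), msBar G Q U i) + κ) * F) * W ≤ R.Gfr j * W :=
      mul_le_mul_of_nonneg_right hkey hWm
    have hsplit : ((G.S j + Q.S' j * |U|) + ((∑ i ∈ range (n + 1), msBar G Q U i) + κ) * F) * W =
        (G.S j + Q.S' j * |U|) * W + ((∑ i ∈ range (n + 1), msBar G Q U i) + κ) * (F * W) := by ring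
    linarith

end Model

end Summit.HubbardSuperconductivity.HubbardSuperconductivity.Theorems.KLRegimeSplit

end
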